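import Literature.Algebra.Homology.OrderedCechShuffleCoefficientRecursion
import Mathlib.Tactic.LinearCombination
import HarnessLib

/-!
# The cochain-map identity of the shuffle coefficients (Eilenberg–Mac Lane 1953, Thm. 5.2, dualised; The Stacks Project, Tag 0BEC)

Layer `Literature/Algebra/Homology` (one proved theorem + private plumbing; 0 `def`, 0 named facts, no instance, no notation).  With
`m(s,t,T) = shuffleCoeff s t T` (`Algebra/Homology/OrderedCechShuffleCoefficient`) the Eilenberg–Zilber / shuffle map on the ordered Čech
complex of a PRODUCT COVER reads `(∇c)_{s,t} = Σ_T m(s,t,T) · c_T`, and the Čech differential is `(dc)_T = Σ_{w ∈ T} ε(T,w) · c_{T ∖ w}` with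
the face sign `ε(T, w) = (-1)^{#{w' ∈ T : w' < w}}` (`OrderedCech.sign`).  THE IDENTITY proved here,

  `Σ_{w ∈ s × t, w ∉ R} m(s,t,R ∪ w) · ε(R ∪ w, w) = Σ_{i ∈ s} ε(s,i) · m(s ∖ i, t, R) + (-1)^{#s-1} · Σ_{j ∈ t} ε(t,j) · m(s, t ∖ j, R)`

for every non-empty `R`, says that the coefficient of `c_R` in `(∇ dc)_{s,t}` equals its coefficient in `(d₁ ∇c + (-1)^{#s-1} d₂ ∇c)_{s,t}`
— i.e. `∇ : Č(𝔚) ⟶ Tot Č•,•` IS A MORPHISM OF COMPLEXES (the consumer `Algebra/Homology/OrderedCechPairSystemShuffle` turns this integer identity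
into the equation of linear maps).  Proof: induction on `#s + #t` through the last vertex (`…Recursion` §4–§5); the two corner fillings of a
diagonal step cancel as the cross terms `± m(s ∖ max s, t ∖ max t, R ∖ w₁)`; the one-vertex level `R = {w₁}` is the `1 × 1` indicator
`sum_shuffleCoeff_singleton`.

Cell `hodgecm-mathlib` (D-0151), F-11 / J3 Künneth packet, brick (K2-c-1) of F0P1b-p04 (planner RULINGS #3 (R15)).  HC_CM is proved only modulo
the 7 printed citations until rung 0 closes — nothing here bears on a summit statement.

## References
* S. Eilenberg, S. Mac Lane, *On the groups `H(Π,n)`, I*, Ann. of Math. 58 (1953), §5, Thm. 5.2 (`∇` is a chain map). [EilenbergMacLane1953]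
* The Stacks Project, Tag 0BEC (Künneth formula via the double Čech complex). [StacksProject]
* U. Görtz, T. Wedhorn, *Algebraic Geometry II* (2023), Def. 21.68 (p. 180) (the Čech differential and its signs). [GortzWedhorn2023]
-/

open Finset

namespace Literature.Algebra.Homology

namespace OrderedCech

variable {ι κ : Type} [LinearOrder ι] [LinearOrder κ]

omit [LinearOrder κ] in
/-- Erasing a non-maximal element does not change the maximum. [folklore] -/
private theorem max'_erase_eq_max' {s : Finset ι} (hs : s.Nonempty) {i : ι} (hi : i ≠ s.max' hs) (h' : (s.erase i).Nonempty) :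
    (s.erase i).max' h' = s.max' hs := by
  refine le_antisymm (Finset.max'_le _ _ _ fun x hx => s.le_max' x (Finset.mem_of_mem_erase hx)) ?_
  exact Finset.le_max' _ _ (Finset.mem_erase.mpr ⟨hi.symm, s.max'_mem hs⟩)


omit [LinearOrder ι] [LinearOrder κ] in
/-- The empty rectangle has no lattice points. [folklore] -/
private theorem image_toLex_eq_empty_left [DecidableEq ι] [DecidableEq κ] (t : Finset κ) :
    ((∅ : Finset ι) ×ˢ t).image (toLex : ι × κ → ι ×ₗ κ) = ∅ := by
  rw [Finset.empty_product, Finset.image_empty]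

omit [LinearOrder ι] [LinearOrder κ] in
/-- The empty rectangle has no lattice points. [folklore] -/
private theorem image_toLex_eq_empty_right [DecidableEq ι] [DecidableEq κ] (s : Finset ι) :
    (s ×ˢ (∅ : Finset κ)).image (toLex : ι × κ → ι ×ₗ κ) = ∅ := by
  rw [Finset.product_empty, Finset.image_empty]


/-! ### §6 The cochain-map identity -/

/-- **THE COCHAIN-MAP IDENTITY of the shuffle coefficients** ([EilenbergMacLane1953] Thm. 5.2, dualised, for the ordered Čech complex of a
product cover): for every non-empty `R ⊆ ι ×ₗ κ`,
`Σ_{w ∈ s × t, w ∉ R} m(s,t,R ∪ w) · ε(R ∪ w, w) = Σ_{i ∈ s} ε(s,i) · m(s ∖ i, t, R) + (-1)^{#s-1} · Σ_{j ∈ t} ε(t,j) · m(s, t ∖ j, R)`.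
Read with `(∇c)_{s,t} = Σ_T m(s,t,T) c_T` and the Čech differential `(dc)_T = Σ_{w ∈ T} ε(T,w) c_{T ∖ w}`, the left side is the coefficient
of `c_R` in `(∇ dc)_{s,t}` and the right side its coefficient in `(d₁ ∇c + (-1)^{#s-1} d₂ ∇c)_{s,t}` — so `∇` is a morphism of complexes
`Č(𝔚) ⟶ Tot Č•,•`.  Proof: induction on `#s + #t` through the last vertex (`sum_shuffleCoeff_insert_of_max_mem`); the two fillings of a
diagonal step cancel as the cross terms `± m(s ∖ max s, t ∖ max t, R ∖ w₁)`. [cite: EilenbergMacLane1953, §5 (Thm. 5.2)]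
[cite: StacksProject, Tag 0BEC] -/
theorem sum_shuffleCoeff_insert_mul_sign (s : Finset ι) (t : Finset κ) {R : Finset (ι ×ₗ κ)} (hR : R.Nonempty) :
    ∑ w ∈ (s ×ˢ t).image toLex \ R, shuffleCoeff s t (insert w R) * sign ℤ (insert w R) w =
      ∑ i ∈ s, sign ℤ s i * shuffleCoeff (s.erase i) t R +
        (-1) ^ (s.card - 1) * ∑ j ∈ t, sign ℤ t j * shuffleCoeff s (t.erase j) R := by
  induction hn : s.card + t.card using Nat.strong_induction_on generalizing s t R with
  | _ n ih =>
  -- the empty rectangles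
  by_cases hs : s.Nonempty
  swap
  · rw [Finset.not_nonempty_iff_eq_empty] at hs
    subst hs
    rw [image_toLex_eq_empty_left, Finset.empty_sdiff, Finset.sum_empty, Finset.sum_empty, zero_add,
      Finset.sum_eq_zero (fun j _ => ?_), mul_zero]
    rw [shuffleCoeff_of_not_nonempty_left Finset.not_nonempty_empty, mul_zero]
  by_cases ht : t.Nonempty
  swap
  · rw [Finset.not_nonempty_iff_eq_empty] at ht
    subst ht
    rw [image_toLex_eq_empty_right, Finset.empty_sdiff, Finset.sum_empty, Finset.sum_empty, mul_zero, add_zero,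
      Finset.sum_eq_zero (fun i _ => ?_)]
    rw [shuffleCoeff_of_not_nonempty_right _ Finset.not_nonempty_empty, mul_zero]
  set w₁ : ι ×ₗ κ := toLex (s.max' hs, t.max' ht) with hw₁def
  -- the `1 × 1` rectangle: every term vanishes
  by_cases h1 : s.card = 1 ∧ t.card = 1
  · have hL : ∀ w ∈ (s ×ˢ t).image toLex \ R, shuffleCoeff s t (insert w R) * sign ℤ (insert w R) w = 0 := by
      intro w hw
      rw [Finset.mem_sdiff] at hw
      rw [shuffleCoeff_of_card_eq_one hs ht h1, if_neg, zero_mul]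
      intro h
      obtain ⟨r, hr⟩ := hR
      have hr' : r ∈ insert w R := Finset.mem_insert_of_mem hr
      have hw' : w ∈ insert w R := Finset.mem_insert_self w R
      rw [h, Finset.mem_singleton] at hr' hw'
      exact hw.2 (hw' ▸ hr' ▸ hr)
    have hs' : ∀ i ∈ s, shuffleCoeff (s.erase i) t R = 0 := fun i hi =>
      shuffleCoeff_of_not_nonempty_left (by
        rw [Finset.not_nonempty_iff_eq_empty, ← Finset.card_eq_zero]
        have := Finset.card_erase_add_one hi; omega) t R
    have ht' : ∀ j ∈ t, shuffleCoeff s (t.erase j) R = 0 := fun j hj =>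
      shuffleCoeff_of_not_nonempty_right s (by
        rw [Finset.not_nonempty_iff_eq_empty, ← Finset.card_eq_zero]
        have := Finset.card_erase_add_one hj; omega) R
    rw [Finset.sum_eq_zero hL, Finset.sum_eq_zero (fun i hi => by rw [hs' i hi, mul_zero]),
      Finset.sum_eq_zero (fun j hj => by rw [ht' j hj, mul_zero]), mul_zero, add_zero]
  by_cases hw₁R : w₁ ∈ R
  · ----------------------------------------------------------------
    -- CASE B: the last vertex lies in `R`
    ----------------------------------------------------------------
    rw [sum_shuffleCoeff_insert_of_max_mem hs ht h1 hw₁R, ← hw₁def]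
    set R' := R.erase w₁ with hR'def
    -- the `i = max s` and `j = max t` terms of the right-hand side vanish
    have hi₁ : shuffleCoeff (s.erase (s.max' hs)) t R = 0 := shuffleCoeff_erase_left_eq_zero_of_mem hw₁R rfl
    have hj₁ : shuffleCoeff s (t.erase (t.max' ht)) R = 0 := shuffleCoeff_erase_right_eq_zero_of_mem hw₁R rfl
    rw [← Finset.add_sum_erase s _ (s.max'_mem hs), ← Finset.add_sum_erase t _ (t.max'_mem ht), hi₁, hj₁, mul_zero,
      zero_add, mul_zero, zero_add]
    by_cases hRw : R = {w₁}
    · -- R' = ∅ : the one-vertex level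
      have hR'e : R' = ∅ := by rw [hR'def, hRw, Finset.erase_singleton]
      rw [hR'e]
      simp_rw [Finset.sdiff_empty, Finset.insert_empty]
      rw [sum_shuffleCoeff_singleton, sum_shuffleCoeff_singleton]
      -- right-hand side: `m(s ∖ i, t, {w₁})` is the `1 × 1` indicator of `(s ∖ i) × t` with corner `w₁`
      have hcs := Finset.card_erase_add_one (s.max'_mem hs)
      have hct := Finset.card_erase_add_one (t.max'_mem ht)
      have hterm_i : ∀ i ∈ s.erase (s.max' hs), sign ℤ s i * shuffleCoeff (s.erase i) t R =
          if (s.erase (s.max' hs)).card = 1 ∧ t.card = 1 then sign ℤ s i else 0 := by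
        intro i hi
        have hi' := Finset.mem_erase.mp hi
        have hne : (s.erase i).Nonempty := ⟨s.max' hs, Finset.mem_erase.mpr ⟨Ne.symm hi'.1, s.max'_mem hs⟩⟩
        have hci : (s.erase i).card = (s.erase (s.max' hs)).card := by
          rw [Finset.card_erase_of_mem hi'.2, Finset.card_erase_of_mem (s.max'_mem hs)]
        by_cases hc : (s.erase (s.max' hs)).card = 1 ∧ t.card = 1
        · rw [if_pos hc, shuffleCoeff_of_card_eq_one hne ht ⟨hci ▸ hc.1, hc.2⟩, max'_erase_eq_max' hs hi'.1 hne, hRw,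
            if_pos rfl, mul_one]
        · rw [if_neg hc]
          have : shuffleCoeff (s.erase i) t R = 0 := by
            by_contra h
            have h2 := card_of_shuffleCoeff_ne_zero h
            rw [hRw, Finset.card_singleton, hci] at h2
            obtain ⟨hs'', ht'', -⟩ := shuffleCoeff_ne_zero_imp h
            have := hs''.card_pos; have := ht''.card_pos
            rw [hci] at *
            exact hc ⟨by omega, by omega⟩
          rw [this, mul_zero]
      have hterm_j : ∀ j ∈ t.erase (t.max' ht), sign ℤ t j * shuffleCoeff s (t.erase j) R =
          if s.card = 1 ∧ (t.erase (t.max' ht)).card = 1 then sign ℤ t j else 0 := by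
        intro j hj
        have hj' := Finset.mem_erase.mp hj
        have hne : (t.erase j).Nonempty := ⟨t.max' ht, Finset.mem_erase.mpr ⟨Ne.symm hj'.1, t.max'_mem ht⟩⟩
        have hcj : (t.erase j).card = (t.erase (t.max' ht)).card := by
          rw [Finset.card_erase_of_mem hj'.2, Finset.card_erase_of_mem (t.max'_mem ht)]
        by_cases hc : s.card = 1 ∧ (t.erase (t.max' ht)).card = 1
        · rw [if_pos hc, shuffleCoeff_of_card_eq_one hs hne ⟨hc.1, hcj ▸ hc.2⟩, max'_erase_eq_max' ht hj'.1 hne, hRw,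
            if_pos rfl, mul_one]
        · rw [if_neg hc]
          have : shuffleCoeff s (t.erase j) R = 0 := by
            by_contra h
            have h2 := card_of_shuffleCoeff_ne_zero h
            rw [hRw, Finset.card_singleton, hcj] at h2
            obtain ⟨hs'', ht'', -⟩ := shuffleCoeff_ne_zero_imp h
            have := hs''.card_pos; have := ht''.card_pos
            rw [hcj] at *
            exact hc ⟨by omega, by omega⟩
          rw [this, mul_zero]
      rw [Finset.sum_congr rfl hterm_i, Finset.sum_congr rfl hterm_j]
      -- the surviving sums: `s ∖ max s = {i₀}` with `ε(s, i₀) = 1`, resp. `t ∖ max t = {j₀}` with `ε(t, j₀) = 1`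
      have hsum_i : (∑ i ∈ s.erase (s.max' hs), if (s.erase (s.max' hs)).card = 1 ∧ t.card = 1 then sign ℤ s i else 0) =
          if (s.erase (s.max' hs)).card = 1 ∧ t.card = 1 then 1 else 0 := by
        by_cases hc : (s.erase (s.max' hs)).card = 1 ∧ t.card = 1
        · simp_rw [if_pos hc]
          obtain ⟨i₀, hi₀⟩ := Finset.card_eq_one.mp hc.1
          rw [hi₀, Finset.sum_singleton]
          have hi₀s : i₀ ∈ s.erase (s.max' hs) := by rw [hi₀]; exact Finset.mem_singleton_self _
          have hi₀' := Finset.mem_erase.mp hi₀s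
          unfold sign
          have : s.filter (· < i₀) = ∅ := by
            rw [Finset.filter_eq_empty_iff]
            intro x hx hlt
            by_cases hxm : x = s.max' hs
            · exact (lt_irrefl _) (lt_of_le_of_lt (s.le_max' i₀ hi₀'.2) (hxm ▸ hlt))
            · have hx' : x ∈ s.erase (s.max' hs) := Finset.mem_erase.mpr ⟨hxm, hx⟩
              rw [hi₀, Finset.mem_singleton] at hx'
              exact (lt_irrefl _) (hx' ▸ hlt)
          rw [this, Finset.card_empty, pow_zero]
        · simp_rw [if_neg hc]; rw [Finset.sum_const_zero]
      have hsum_j : (∑ j ∈ t.erase (t.max' ht), if s.card = 1 ∧ (t.erase (t.max' ht)).card = 1 then sign ℤ t j else 0) =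
          if s.card = 1 ∧ (t.erase (t.max' ht)).card = 1 then 1 else 0 := by
        by_cases hc : s.card = 1 ∧ (t.erase (t.max' ht)).card = 1
        · simp_rw [if_pos hc]
          obtain ⟨j₀, hj₀⟩ := Finset.card_eq_one.mp hc.2
          rw [hj₀, Finset.sum_singleton]
          have hj₀t : j₀ ∈ t.erase (t.max' ht) := by rw [hj₀]; exact Finset.mem_singleton_self _
          have hj₀' := Finset.mem_erase.mp hj₀t
          unfold sign
          have : t.filter (· < j₀) = ∅ := by
            rw [Finset.filter_eq_empty_iff]
            intro x hx hlt
            by_cases hxm : x = t.max' ht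
            · exact (lt_irrefl _) (lt_of_le_of_lt (t.le_max' j₀ hj₀'.2) (hxm ▸ hlt))
            · have hx' : x ∈ t.erase (t.max' ht) := Finset.mem_erase.mpr ⟨hxm, hx⟩
              rw [hj₀, Finset.mem_singleton] at hx'
              exact (lt_irrefl _) (hx' ▸ hlt)
          rw [this, Finset.card_empty, pow_zero]
        · simp_rw [if_neg hc]; rw [Finset.sum_const_zero]
      rw [hsum_i, hsum_j]
      -- now both sides are indicators; compare the cardinality cases
      by_cases hc1 : (s.erase (s.max' hs)).card = 1 ∧ t.card = 1
      · have hc2 : ¬ (s.card = 1 ∧ (t.erase (t.max' ht)).card = 1) := by omega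
        rw [if_pos hc1, if_neg hc2, hc1.2]
        simp
      · rw [if_neg hc1]
        by_cases hc2 : s.card = 1 ∧ (t.erase (t.max' ht)).card = 1
        · rw [if_pos hc2, hc2.1]
          simp
        · rw [if_neg hc2]
          simp
    · ----- R' non-empty: induction on both recursive sums
      have hR'ne : R'.Nonempty := by
        rw [hR'def]
        obtain ⟨r, hr, hrne⟩ : ∃ r ∈ R, r ≠ w₁ := by
          by_contra hcon
          apply hRw
          ext r
          rw [Finset.mem_singleton]
          constructor
          · intro hr
            by_contra hne
            exact hcon ⟨r, hr, hne⟩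
          · rintro rfl; exact hw₁R
        exact ⟨r, Finset.mem_erase.mpr ⟨hrne, hr⟩⟩
      have hcs := Finset.card_erase_add_one (s.max'_mem hs)
      have hct := Finset.card_erase_add_one (t.max'_mem ht)
      have ih₁ := ih ((s.erase (s.max' hs)).card + t.card) (by omega) (s.erase (s.max' hs)) t hR'ne rfl
      have ih₂ := ih (s.card + (t.erase (t.max' ht)).card) (by omega) s (t.erase (t.max' ht)) hR'ne rfl
      rw [ih₁, ih₂]
      -- unfold the right-hand side terms over `s ∖ max s` and `t ∖ max t`
      have hU_i : ∀ i ∈ s.erase (s.max' hs), sign ℤ s i * shuffleCoeff (s.erase i) t R =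
          sign ℤ s i * ((-1) ^ (t.card - 1) * shuffleCoeff ((s.erase (s.max' hs)).erase i) t R' +
            shuffleCoeff (s.erase i) (t.erase (t.max' ht)) R') := by
        intro i hi
        have hi' := (Finset.mem_erase.mp hi).1
        rw [shuffleCoeff_erase_left_unfold hs ht hw₁R hRw hi', Finset.erase_right_comm]
      have hU_j : ∀ j ∈ t.erase (t.max' ht), sign ℤ t j * shuffleCoeff s (t.erase j) R =
          sign ℤ t j * ((-1) ^ (t.card - 1 - 1) * shuffleCoeff (s.erase (s.max' hs)) (t.erase j) R' +
            shuffleCoeff s ((t.erase (t.max' ht)).erase j) R') := by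
        intro j hj
        have hj' := Finset.mem_erase.mp hj
        rw [shuffleCoeff_erase_right_unfold hs ht hw₁R hRw hj'.1, Finset.erase_right_comm, Finset.card_erase_of_mem hj'.2]
      rw [Finset.sum_congr rfl hU_i, Finset.sum_congr rfl hU_j]
      -- the signs over the smaller rectangles agree with those over `s`, `t`
      have hS_i : ∀ i ∈ s.erase (s.max' hs), sign ℤ (s.erase (s.max' hs)) i = sign ℤ s i := fun i hi =>
        sign_erase_of_not_lt (fun h => (Finset.mem_erase.mp hi).1
          (le_antisymm (s.le_max' i (Finset.mem_erase.mp hi).2) h.le))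
      have hS_j : ∀ j ∈ t.erase (t.max' ht), sign ℤ (t.erase (t.max' ht)) j = sign ℤ t j := fun j hj =>
        sign_erase_of_not_lt (fun h => (Finset.mem_erase.mp hj).1
          (le_antisymm (t.le_max' j (Finset.mem_erase.mp hj).2) h.le))
      have E1 : (∑ i ∈ s.erase (s.max' hs), sign ℤ (s.erase (s.max' hs)) i *
            shuffleCoeff ((s.erase (s.max' hs)).erase i) t R') =
          ∑ i ∈ s.erase (s.max' hs), sign ℤ s i * shuffleCoeff ((s.erase (s.max' hs)).erase i) t R' :=
        Finset.sum_congr rfl fun i hi => by rw [hS_i i hi]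
      have E2 : (∑ j ∈ t.erase (t.max' ht), sign ℤ (t.erase (t.max' ht)) j *
            shuffleCoeff s ((t.erase (t.max' ht)).erase j) R') =
          ∑ j ∈ t.erase (t.max' ht), sign ℤ t j * shuffleCoeff s ((t.erase (t.max' ht)).erase j) R' :=
        Finset.sum_congr rfl fun j hj => by rw [hS_j j hj]
      have E3 : (∑ j ∈ t, sign ℤ t j * shuffleCoeff (s.erase (s.max' hs)) (t.erase j) R') =
          sign ℤ t (t.max' ht) * shuffleCoeff (s.erase (s.max' hs)) (t.erase (t.max' ht)) R' +
            ∑ j ∈ t.erase (t.max' ht), sign ℤ t j * shuffleCoeff (s.erase (s.max' hs)) (t.erase j) R' :=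
        (Finset.add_sum_erase t _ (t.max'_mem ht)).symm
      have E4 : (∑ i ∈ s, sign ℤ s i * shuffleCoeff (s.erase i) (t.erase (t.max' ht)) R') =
          sign ℤ s (s.max' hs) * shuffleCoeff (s.erase (s.max' hs)) (t.erase (t.max' ht)) R' +
            ∑ i ∈ s.erase (s.max' hs), sign ℤ s i * shuffleCoeff (s.erase i) (t.erase (t.max' ht)) R' :=
        (Finset.add_sum_erase s _ (s.max'_mem hs)).symm
      rw [E1, E2, E3, E4]
      -- name the pieces
      set M := shuffleCoeff (s.erase (s.max' hs)) (t.erase (t.max' ht)) R' with hM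
      set A₁ := ∑ i ∈ s.erase (s.max' hs), sign ℤ s i * shuffleCoeff ((s.erase (s.max' hs)).erase i) t R' with hA₁
      set A₂ := ∑ i ∈ s.erase (s.max' hs), sign ℤ s i * shuffleCoeff (s.erase i) (t.erase (t.max' ht)) R' with hA₂
      set A₃ := ∑ j ∈ t.erase (t.max' ht), sign ℤ t j * shuffleCoeff (s.erase (s.max' hs)) (t.erase j) R' with hA₃
      set A₄ := ∑ j ∈ t.erase (t.max' ht), sign ℤ t j * shuffleCoeff s ((t.erase (t.max' ht)).erase j) R' with hA₄
      have eR : (∑ i ∈ s.erase (s.max' hs), sign ℤ s i * ((-1) ^ (t.card - 1) *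
              shuffleCoeff ((s.erase (s.max' hs)).erase i) t R' + shuffleCoeff (s.erase i) (t.erase (t.max' ht)) R')) =
            (-1) ^ (t.card - 1) * A₁ + A₂ := by
        rw [hA₁, hA₂, Finset.mul_sum, ← Finset.sum_add_distrib]
        refine Finset.sum_congr rfl fun i _ => by ring
      have eR' : (∑ j ∈ t.erase (t.max' ht), sign ℤ t j * ((-1) ^ (t.card - 1 - 1) *
              shuffleCoeff (s.erase (s.max' hs)) (t.erase j) R' + shuffleCoeff s ((t.erase (t.max' ht)).erase j) R')) =
            (-1) ^ (t.card - 1 - 1) * A₃ + A₄ := by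
        rw [hA₃, hA₄, Finset.mul_sum, ← Finset.sum_add_distrib]
        refine Finset.sum_congr rfl fun j _ => by ring
      rw [eR, eR']
      -- sub-cases on the emptiness of `s ∖ max s` and `t ∖ max t` (the exponents are honest only when non-empty)
      by_cases hs' : (s.erase (s.max' hs)).Nonempty
      · have ha : s.card - 1 = ((s.erase (s.max' hs)).card - 1) + 1 := by have := hs'.card_pos; omega
        by_cases ht' : (t.erase (t.max' ht)).Nonempty
        · have hb : t.card - 1 = (t.card - 1 - 1) + 1 := by have := ht'.card_pos; omega
          rw [sign_max' hs, sign_max' ht, ha]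
          set p := (-1 : ℤ) ^ (t.card - 1 - 1) with hp
          set q := (-1 : ℤ) ^ ((s.erase (s.max' hs)).card - 1) with hq
          have hp2 : p * p = 1 := by
            rw [hp, ← pow_add, ← two_mul, pow_mul, neg_one_sq, one_pow]
          rw [hb, pow_succ, pow_succ]
          linear_combination (q * M) * hp2
        · rw [Finset.not_nonempty_iff_eq_empty] at ht'
          have hA₃0 : A₃ = 0 := by rw [hA₃, ht', Finset.sum_empty]
          have hA₄0 : A₄ = 0 := by rw [hA₄, ht', Finset.sum_empty]
          have hM0 : M = 0 := by rw [hM, ht', shuffleCoeff_of_not_nonempty_right _ Finset.not_nonempty_empty]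
          rw [hA₃0, hA₄0, hM0, sign_max' hs, ha, pow_succ]
          ring
      · rw [Finset.not_nonempty_iff_eq_empty] at hs'
        have hA₁0 : A₁ = 0 := by rw [hA₁, hs', Finset.sum_empty]
        have hA₂0 : A₂ = 0 := by rw [hA₂, hs', Finset.sum_empty]
        have hA₃0 : A₃ = 0 := by
          rw [hA₃]; exact Finset.sum_eq_zero fun j _ => by
            rw [hs', shuffleCoeff_of_not_nonempty_left Finset.not_nonempty_empty, mul_zero]
        have hM0 : M = 0 := by rw [hM, hs', shuffleCoeff_of_not_nonempty_left Finset.not_nonempty_empty]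
        rw [hA₁0, hA₂0, hA₃0, hM0]
        ring
  · ----------------------------------------------------------------
    -- CASE A: the last vertex is not in `R` — only `w = w₁`, `i = max s`, `j = max t` survive
    ----------------------------------------------------------------
    have hw₁S : w₁ ∈ (s ×ˢ t).image toLex \ R :=
      Finset.mem_sdiff.mpr ⟨mem_image_toLex.mpr ⟨s.max'_mem hs, t.max'_mem ht⟩, hw₁R⟩
    rw [Finset.sum_eq_single_of_mem w₁ hw₁S (fun w hw hne => by
      rw [shuffleCoeff_eq_zero_of_max_not_mem hs ht (fun h => ?_), zero_mul]
      rcases Finset.mem_insert.mp h with h | h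
      · exact hne h.symm
      · exact hw₁R h)]
    rw [shuffleCoeff_unfold hs ht (Finset.mem_insert_self w₁ R), Finset.erase_insert hw₁R,
      if_neg (fun h => h1 ⟨h.1, h.2.1⟩), add_zero]
    rw [Finset.sum_eq_single_of_mem (s.max' hs) (s.max'_mem hs) (fun i _ hne => by
      rw [shuffleCoeff_erase_left_eq_zero_of_max_not_mem hs ht hw₁R hne, mul_zero])]
    rw [Finset.sum_eq_single_of_mem (t.max' ht) (t.max'_mem ht) (fun j _ hne => by
      rw [shuffleCoeff_erase_right_eq_zero_of_max_not_mem hs ht hw₁R hne, mul_zero])]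
    rw [sign_max' hs, sign_max' ht]
    -- the sign of the new top vertex
    by_cases hM : shuffleCoeff (s.erase (s.max' hs)) t R = 0 ∧ shuffleCoeff s (t.erase (t.max' ht)) R = 0
    · rw [hM.1, hM.2]; ring
    · have hlt : ∀ w ∈ R, w < w₁ := by
        intro w hw
        rcases not_and_or.mp hM with h | h
        · obtain ⟨h1', -⟩ := mem_of_shuffleCoeff_ne_zero h hw
          have h1'' := Finset.mem_erase.mp h1'
          exact Prod.Lex.lt_iff.mpr (Or.inl (lt_of_le_of_ne (s.le_max' _ h1''.2) h1''.1))
        · obtain ⟨h1', h2'⟩ := mem_of_shuffleCoeff_ne_zero h hw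
          have h2'' := Finset.mem_erase.mp h2'
          rcases (s.le_max' _ h1').lt_or_eq with hl | he
          · exact Prod.Lex.lt_iff.mpr (Or.inl hl)
          · exact Prod.Lex.lt_iff.mpr (Or.inr ⟨he, lt_of_le_of_ne (t.le_max' _ h2''.2) h2''.1⟩)
      have hcardR : R.card = (s.card - 1) + (t.card - 1) := by
        have hcs := Finset.card_erase_add_one (s.max'_mem hs)
        have hct := Finset.card_erase_add_one (t.max'_mem ht)
        rcases not_and_or.mp hM with h | h
        · have := card_of_shuffleCoeff_ne_zero h; omega
        · have := card_of_shuffleCoeff_ne_zero h; omega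
      rw [sign_insert_self_of_forall_lt hlt, hcardR, pow_add]
      rcases neg_one_pow_eq_or ℤ (t.card - 1) with h2 | h2 <;> rw [h2] <;> ring

end OrderedCech

end Literature.Algebra.Homology
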